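import Summits.PneNP.PneNP.Theses.ChebyshevTracialDesign
import Summits.PneNP.PneNP.Theorems.ChebyshevTracialDesignAssembly2
import Summits.PneNP.PneNP.Theorems.ChebyshevTracialDesignPsdHyperplaneBound
import HarnessLib

/-!
# Route `ChebyshevTracialDesign`: the assembly item (rev 5), closed by the proved seam and support

`Assembly := TracialDecayExp20 → ChebyshevDesign20 → Summit.PneNP.MatchingPsdRank.MatchingPsdRankStretchedExp`
(stmt-PneNP-19664): the two cruxes decide rung F-N2 through the route's deciding theorem `closes`, whose other two
binders are PROVED in the tree — the support `PsdHyperplaneBound` (`Summit.PneNP.PneNP.Theorems.PsdHyperplaneBound_proof`,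
Briët–Dadush–Pokutta rescaling) and the exp-normalised seam `Assembly2` (`Summit.PneNP.PneNP.Theorems.Assembly2_proof`,
stmt-PneNP-19885). Pure composition; the open content of the route is the crux `TracialDecayExp20` (stmt-PneNP-19878) alone.
-/

set_option linter.dupNamespace false -- `Summit.PneNP.PneNP.…`: summit = sub-problem (D-0017)

namespace Summit.PneNP.PneNP.Theorems

/-- **The assembly of route `ChebyshevTracialDesign` (rev 5):** the exp-normalised tracial decay crux and the Chebyshev
design crux imply the rung leaf `MatchingPsdRankStretchedExp`, via the route's deciding theorem with the proved support
`PsdHyperplaneBound` and the proved seam `Assembly2`. -/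
theorem ChebyshevTracialDesign_Assembly_proof :
    Summit.PneNP.PneNP.Theses.ChebyshevTracialDesign.Assembly :=
  fun hE h3 => Summit.PneNP.PneNP.Theses.ChebyshevTracialDesign.closes hE h3 PsdHyperplaneBound_proof Assembly2_proof

end Summit.PneNP.PneNP.Theorems
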